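import Literature.IUT.HodgeTheaters.LocalFrobenioidsArch
import Literature.AnabelianGeometry.AbsoluteAnabelian.AbsTopIII.RemarksArchimedeanProofs
import Mathlib.Analysis.SpecificLimits.Normed
import HarnessLib

/-!
# [IUTchII] Prop 4.4 (i), (ii) [unit part] at archimedean primes — REAL statements over abc-iut-L5-t2's
# `ArchLocalFrobenioid` ([IUTchI] Ex 3.4), with proofs

S. Mochizuki, *Inter-universal Teichmüller theory II*, §4, kurims manuscript (Dec. 2020), Proposition 4.4
(i), (ii) pp. 129–130 (`v ∈ V^arc`), read on the page (lit key `paper:url-5036b4059555`, pp. 127–131)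
[cite: Mochizuki2012, Prop 4.4 p.129]. Claim key DISPUTED (D-0012). Printed proof (p. 131): "The various
assertions of Proposition 4.4 follow immediately from the definitions and the references quoted in the
statements of these assertions." Companions: `GoodPrimeKummerBridge.lean` (Prop 4.2 (i), (ii) over
[AbsTopIII] §3 pairs), `GoodPrimeKummerBridgeTheta.lean` (Prop 4.2/4.4 (iii), (iv)).

WHY THIS FILE. `GoodPrimeFrobenioidMonoids.lean` (abc-iut-L6-t2, p404158) records Prop 4.4 (i) and the unit
part of (ii) as BARE `Prop` FIELDS `Prop44Statements.constantKummer` / `.unitOrbit` (slots; DISCHARGE-L6 §F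
row F9). The objects the print names are typed by abc-iut-L5-t2's [IUTchI] Example 3.4 interface
`Literature.IUT.HodgeTheaters.ArchLocalFrobenioid` (p404560): `Ψ_{†F_v} := O^▷(†C_v)` = `X.OC`, the Kummer
structure `†κ_v : O^▷(†C_v) ↪ 𝒜_{†D_v}` = `X.kappa` (DEFINED there from the two recorded natural isomorphisms
`O^▷(C_v) ⥲ O^▷_{K_v}` and `K_v ⥲ 𝒜_{D_v}`), the CAF `𝒜_{†D_v}` = `X.Afield` ("which may be algorithmically
constructed from" `†D_v = †U_v`, [AbsTopIII] Cor 2.7 (e)), so that `Ψ_cns(†U_v) := A^▷_{†U_v}` (Prop 4.3 (i)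
p. 127: "the topological monoid of nonzero elements of absolute value `≤ 1`") = `unitDiscMonoid X.Afield`,
and `Ψ^×_{†F^⊢_v}`, `Ψ_cns(†D^⊢_v)^×` (the submonoids of invertible elements of `O^▷(†C^⊢_v)`, `O^▷_{𝒜_{†D_v}}`;
[IUTchI] Ex 3.4 (ii) p. 81: "`C^×`, which is necessarily isomorphic to `S¹`, denotes the topological submonoid
of invertible elements") = the unit circles.

WHAT THE KERNEL IS MADE TO SAY.
* (i) p. 129 "the Kummer structure `†κ_v : Ψ_{†F_v} := O^▷(†C_v) ↪ A^{†D_v}` on the category `†C_v`, together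
  with the tautological equality `†D_v = †U_v` of Aut-holomorphic spaces, determine a unique isomorphism
  `Ψ_{†F_v} ⥲ Ψ_cns(†U_v)` of topological monoids": PROVED for every `X : ArchLocalFrobenioid K_v` —
  `range X.kappa = A^▷_{𝒜_{†D_v}}` (`range_kappa`; a bicontinuous ring isomorphism of normed fields preserves
  the closed unit disc, `norm_map_le_one_iff`), the factorisation `kummerIsoArch : O^▷(†C_v) ⥲ A^▷` of `†κ_v`
  (`coe_kummerIsoArch`), bicontinuous (`kummerIsoArch_continuous`, `kummerIsoArch_symm_continuous`), and
  UNIQUE among isomorphisms through which `†κ_v` factors (`Prop44i`, `Prop44i_holds`).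
* (ii) p. 129–130, unit part "there exists a unique `{±1}`-orbit of isomorphisms of topological groups
  `Ψ^×_{†F^⊢_v} ⥲ Ψ_cns(†D^⊢_v)^×`": PROVED — for unit circles of two complex archimedean fields there are EXACTLY
  two isomorphisms of topological groups, differing by inversion (`orbit_of_equiv_circle`, `orbit_sphere`,
  from the tree's classification of the continuous automorphisms of `S¹`,
  `AbsTopIII.Rmk_2_7_3.CircleAutOrderTwo_holds`); the units of `O^▷` ARE the unit circle
  (`isUnit_iff_norm_eq_one`), and the statement for `X` is `Prop44iiUnit X`, PROVED (`Prop44iiUnit_holds`)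
  (`Ψ^×_{†F^⊢_v} ≅ S¹(K_v)` via `isoOK`, `Ψ_cns(†D^⊢_v)^× = S¹(𝒜_{†D_v})`).

HONEST FRAMING. Elementary complex analysis over the cell's interface; nothing here bears on [IUTchIII]
Cor. 3.12 or takes a side; typed ≠ discharged elsewhere.
-/

noncomputable section

namespace Literature.IUT.HodgeArakelov

open _root_.Filter Literature.IUT.HodgeTheaters
open scoped _root_.Topology

universe u

namespace GoodPrimeKummer

/-! ### 1. Bicontinuous isomorphisms of normed fields preserve the unit disc and the unit circle -/

section NormedFields

variable {K L : Type*} [NormedField K] [NormedField L]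

/-- A continuous ring homomorphism of normed fields maps the open unit disc into the open unit disc
(`‖z‖ < 1 ⟺ zⁿ → 0`). [folklore] -/
private theorem norm_map_lt_one (φ : K →+* L) (hφ : Continuous φ) {z : K} (hz : ‖z‖ < 1) : ‖φ z‖ < 1 := by
  rw [← tendsto_pow_atTop_nhds_zero_iff_norm_lt_one] at hz ⊢
  have h : Tendsto (fun n : ℕ => φ (z ^ n)) atTop (𝓝 (φ 0)) := (hφ.tendsto 0).comp hz
  simpa only [map_pow, map_zero] using h

/-- A bicontinuous ring isomorphism of normed fields satisfies `‖φ z‖ < 1 ⟺ ‖z‖ < 1`. [folklore] -/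
private theorem norm_map_lt_one_iff (φ : K ≃+* L) (hφ : Continuous φ) (hφ' : Continuous φ.symm) (z : K) :
    ‖φ z‖ < 1 ↔ ‖z‖ < 1 := by
  refine ⟨fun h => ?_, fun h => norm_map_lt_one φ.toRingHom hφ h⟩
  have h1 := norm_map_lt_one φ.symm.toRingHom hφ' h
  simpa using h1

/-- A bicontinuous ring isomorphism of normed fields preserves the closed unit disc: `‖φ z‖ ≤ 1 ⟺ ‖z‖ ≤ 1`
(apply the open-disc statement to `z⁻¹`). [folklore] -/
private theorem norm_map_le_one_iff (φ : K ≃+* L) (hφ : Continuous φ) (hφ' : Continuous φ.symm) (z : K) :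
    ‖φ z‖ ≤ 1 ↔ ‖z‖ ≤ 1 := by
  rcases eq_or_ne z 0 with rfl | hz
  · simp
  have hpos : 0 < ‖z‖ := norm_pos_iff.2 hz
  have hpos' : 0 < ‖φ z‖ := norm_pos_iff.2 ((map_ne_zero φ).2 hz)
  have h := norm_map_lt_one_iff φ hφ hφ' z⁻¹
  rw [map_inv₀, norm_inv, norm_inv, inv_lt_one₀ hpos', inv_lt_one₀ hpos] at h
  rw [← not_lt, ← not_lt, h]

/-- A bicontinuous ring isomorphism of normed fields preserves the unit circle: `‖φ z‖ = 1 ⟺ ‖z‖ = 1`.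
[folklore] -/
private theorem norm_map_eq_one_iff (φ : K ≃+* L) (hφ : Continuous φ) (hφ' : Continuous φ.symm) (z : K) :
    ‖φ z‖ = 1 ↔ ‖z‖ = 1 := by
  have h1 := norm_map_le_one_iff φ hφ hφ' z
  have h2 := norm_map_lt_one_iff φ hφ hφ' z
  constructor
  · intro h
    exact le_antisymm (h1.1 h.le) (not_lt.1 fun hlt => (h2.2 hlt).ne h)
  · intro h
    exact le_antisymm (h1.2 h.le) (not_lt.1 fun hlt => (h2.1 hlt).ne h)

/-- The isomorphism of closed unit-disc monoids `O^▷_K ⥲ O^▷_L` induced by a bicontinuous ring isomorphism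
`φ : K ⥲ L` of normed fields (`φ` on underlying elements). [folklore] -/
def unitDiscMonoidEquiv (φ : K ≃+* L) (hφ : Continuous φ) (hφ' : Continuous φ.symm) :
    unitDiscMonoid K ≃* unitDiscMonoid L where
  toFun z := ⟨φ (z : K), (map_ne_zero φ).2 z.2.1, (norm_map_le_one_iff φ hφ hφ' _).2 z.2.2⟩
  invFun w := ⟨φ.symm (w : L), (map_ne_zero φ.symm).2 w.2.1,
    (norm_map_le_one_iff φ.symm hφ' (by simpa using hφ) _).2 w.2.2⟩
  left_inv z := Subtype.ext (φ.symm_apply_apply z)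
  right_inv w := Subtype.ext (φ.apply_symm_apply w)
  map_mul' z w := Subtype.ext (map_mul φ (z : K) (w : K))

/-- `unitDiscMonoidEquiv` is continuous. [folklore] -/
private theorem unitDiscMonoidEquiv_continuous (φ : K ≃+* L) (hφ : Continuous φ) (hφ' : Continuous φ.symm) :
    Continuous (unitDiscMonoidEquiv φ hφ hφ') :=
  (hφ.comp continuous_subtype_val).subtype_mk _

/-- The inverse of `unitDiscMonoidEquiv` is continuous. [folklore] -/
private theorem unitDiscMonoidEquiv_symm_continuous (φ : K ≃+* L) (hφ : Continuous φ)
    (hφ' : Continuous φ.symm) : Continuous (unitDiscMonoidEquiv φ hφ hφ').symm :=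
  (hφ'.comp continuous_subtype_val).subtype_mk _

/-- The isomorphism of unit-circle groups `S¹(K) ⥲ S¹(L)` (topological groups, Mathlib's
`Metric.sphere 0 1`) induced by a bicontinuous ring isomorphism of normed fields. [folklore] -/
def sphereEquiv (φ : K ≃+* L) (hφ : Continuous φ) (hφ' : Continuous φ.symm) :
    Metric.sphere (0 : K) 1 ≃ₜ* Metric.sphere (0 : L) 1 :=
  { toFun := fun z => ⟨φ (z : K), mem_sphere_zero_iff_norm.2
        ((norm_map_eq_one_iff φ hφ hφ' _).2 (mem_sphere_zero_iff_norm.1 z.2))⟩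
    invFun := fun w => ⟨φ.symm (w : L), mem_sphere_zero_iff_norm.2
        ((norm_map_eq_one_iff φ.symm hφ' (by simpa using hφ) _).2 (mem_sphere_zero_iff_norm.1 w.2))⟩
    left_inv := fun z => Subtype.ext (φ.symm_apply_apply z)
    right_inv := fun w => Subtype.ext (φ.apply_symm_apply w)
    map_mul' := fun z w => Subtype.ext (by
      change φ ((z : K) * (w : K)) = φ (z : K) * φ (w : K)
      exact map_mul φ _ _)
    continuous_toFun := (hφ.comp continuous_subtype_val).subtype_mk _
    continuous_invFun := (hφ'.comp continuous_subtype_val).subtype_mk _ }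

/-- The units of the closed unit-disc monoid `O^▷_K` have norm `1` ([IUTchI] Ex 3.4 (ii) p. 81: "`C^×`,
which is necessarily isomorphic to `S¹`, denotes the topological submonoid of invertible elements").
[cite: Mochizuki2012, I Ex 3.4 (ii) p.81] -/
theorem norm_eq_one_of_isUnit {z : unitDiscMonoid K} (hz : IsUnit z) : ‖(z : K)‖ = 1 := by
  obtain ⟨u, rfl⟩ := hz
  have h1 : ((u : unitDiscMonoid K) : K) * ((u⁻¹ : (unitDiscMonoid K)ˣ) : unitDiscMonoid K) = 1 := by
    rw [← Submonoid.coe_mul, Units.mul_inv]; rfl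
  have hn := congrArg norm h1
  rw [norm_mul, norm_one] at hn
  have ha : ‖((u : unitDiscMonoid K) : K)‖ ≤ 1 := (u : unitDiscMonoid K).2.2
  have hb : ‖(((u⁻¹ : (unitDiscMonoid K)ˣ) : unitDiscMonoid K) : K)‖ ≤ 1 :=
    ((u⁻¹ : (unitDiscMonoid K)ˣ) : unitDiscMonoid K).2.2
  nlinarith [norm_nonneg (((u⁻¹ : (unitDiscMonoid K)ˣ) : unitDiscMonoid K) : K), norm_nonneg ((u : unitDiscMonoid K) : K)]

/-- Conversely an element of `O^▷_K` of norm `1` is a unit of `O^▷_K` ([IUTchI] Ex 3.4 (ii) p. 81, the same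
clause). [cite: Mochizuki2012, I Ex 3.4 (ii) p.81] -/
theorem isUnit_of_norm_eq_one {z : unitDiscMonoid K} (hz : ‖(z : K)‖ = 1) : IsUnit z := by
  have hz0 : (z : K) ≠ 0 := z.2.1
  refine ⟨⟨z, ⟨(z : K)⁻¹, inv_ne_zero hz0, by rw [norm_inv, hz, inv_one]⟩,
    Subtype.ext (mul_inv_cancel₀ hz0), Subtype.ext (inv_mul_cancel₀ hz0)⟩, rfl⟩

/-- `(O^▷_K)^× = S¹(K)`: a member of `O^▷_K` is a unit iff it has norm `1` ([IUTchI] Ex 3.4 (ii) p. 81 "`C^×`,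
which is necessarily isomorphic to `S¹`"). [cite: Mochizuki2012, I Ex 3.4 (ii) p.81] -/
theorem isUnit_iff_norm_eq_one (z : unitDiscMonoid K) : IsUnit z ↔ ‖(z : K)‖ = 1 :=
  ⟨norm_eq_one_of_isUnit, isUnit_of_norm_eq_one⟩

/-- The group isomorphism `(O^▷_K)^× ⥲ S¹(K)` onto Mathlib's unit sphere (underlying elements unchanged).
[folklore] -/
def unitsUnitDiscEquivSphere : (unitDiscMonoid K)ˣ ≃* Metric.sphere (0 : K) 1 where
  toFun u := ⟨((u : unitDiscMonoid K) : K), mem_sphere_zero_iff_norm.2 (norm_eq_one_of_isUnit u.isUnit)⟩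
  invFun z := (isUnit_of_norm_eq_one (z := ⟨(z : K), ne_zero_of_mem_unit_sphere z,
      (mem_sphere_zero_iff_norm.1 z.2).le⟩) (mem_sphere_zero_iff_norm.1 z.2)).unit
  left_inv _ := Units.ext (Subtype.ext rfl)
  right_inv _ := Subtype.ext rfl
  map_mul' _ _ := Subtype.ext rfl

end NormedFields

/-! ### 2. Prop 4.4 (i): the Kummer structure determines a unique isomorphism `Ψ_{†F_v} ⥲ Ψ_cns(†U_v)` -/

section ConstantMonoids

variable {Kv : Type u} [NormedField Kv] [NormedAlgebra ℝ Kv] (X : ArchLocalFrobenioid.{u} Kv)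

/-- The Kummer structure `†κ_v` factors through `Ψ_cns(†U_v) := A^▷_{†U_v}` ("nonzero elements of absolute
value `≤ 1`", Prop 4.3 (i) p. 127) — `†κ_v` is the composite of `O^▷(C_v) ⥲ O^▷_{K_v}` with the topological
field isomorphism `K_v ⥲ 𝒜_{D_v}`, which preserves the closed unit disc. [cite: Mochizuki2012, Prop 4.4 (i) p.129] -/
theorem kappa_mem_unitDiscMonoid (m : X.OC) : X.kappa m ∈ unitDiscMonoid X.Afield :=
  (unitDiscMonoidEquiv X.fieldIso X.fieldIso_continuous X.fieldIso_continuous_symm (X.isoOK m)).2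

/-- `†κ_v m = (K_v ⥲ 𝒜_{D_v}) (O^▷(C_v) ⥲ O^▷_{K_v}) (m)` (unfolding abc-iut-L5-t2's definition).
[cite: Mochizuki2012, Prop 4.4 (i) p.129] -/
theorem kappa_apply (m : X.OC) : X.kappa m = X.fieldIso ((X.isoOK m : unitDiscMonoid Kv) : Kv) := rfl

/-- The image of the Kummer structure is EXACTLY `Ψ_cns(†U_v) = A^▷_{𝒜_{†D_v}}`. [cite: Mochizuki2012, Prop 4.4 (i) p.129] -/
theorem range_kappa : Set.range X.kappa = (unitDiscMonoid X.Afield : Set X.Afield) := by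
  ext a
  constructor
  · rintro ⟨m, rfl⟩
    exact kappa_mem_unitDiscMonoid X m
  · intro ha
    set ψ := unitDiscMonoidEquiv X.fieldIso X.fieldIso_continuous X.fieldIso_continuous_symm with hψ
    refine ⟨X.isoOK.symm (ψ.symm ⟨a, ha⟩), ?_⟩
    rw [kappa_apply, MulEquiv.apply_symm_apply]
    exact congrArg Subtype.val (ψ.apply_symm_apply ⟨a, ha⟩)

/-- **The isomorphism `Ψ_{†F_v} ⥲ Ψ_cns(†U_v)` of [IUTchII] Prop 4.4 (i)** (p. 129), CONSTRUCTED: the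
corestriction of `†κ_v` to its image `A^▷_{𝒜_{†D_v}}`. [cite: Mochizuki2012, Prop 4.4 (i) p.129] -/
def kummerIsoArch : X.OC ≃* unitDiscMonoid X.Afield :=
  X.isoOK.trans (unitDiscMonoidEquiv X.fieldIso X.fieldIso_continuous X.fieldIso_continuous_symm)

/-- `†κ_v` factors through `kummerIsoArch` followed by the inclusion `A^▷ ⊆ 𝒜_{†D_v}`.
[cite: Mochizuki2012, Prop 4.4 (i) p.129] -/
@[simp] theorem coe_kummerIsoArch (m : X.OC) : (kummerIsoArch X m : X.Afield) = X.kappa m := rfl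

/-- "of topological monoids": `kummerIsoArch` is continuous … [cite: Mochizuki2012, Prop 4.4 (i) p.129] -/
theorem kummerIsoArch_continuous : Continuous (kummerIsoArch X) :=
  (unitDiscMonoidEquiv_continuous X.fieldIso X.fieldIso_continuous X.fieldIso_continuous_symm).comp
    X.isoOK_continuous

/-- … with continuous inverse. [cite: Mochizuki2012, Prop 4.4 (i) p.129] -/
theorem kummerIsoArch_symm_continuous : Continuous (kummerIsoArch X).symm :=
  X.isoOK_continuous_symm.comp
    (unitDiscMonoidEquiv_symm_continuous X.fieldIso X.fieldIso_continuous X.fieldIso_continuous_symm)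

/-- **REAL STATEMENT of [IUTchII] Prop 4.4 (i)** (p. 129: "the Kummer structure `†κ_v : Ψ_{†F_v} := O^▷(†C_v) ↪
A^{†D_v}` on the category `†C_v`, together with the tautological equality `†D_v = †U_v` of Aut-holomorphic
spaces, determine a unique isomorphism `Ψ_{†F_v} ⥲ Ψ_cns(†U_v)` of topological monoids"): there is EXACTLY
ONE isomorphism of monoids `O^▷(†C_v) ⥲ A^▷_{𝒜_{†D_v}}` through which `†κ_v` factors. The slot it makes real:
`Prop44Statements.constantKummer` (p404158). [cite: Mochizuki2012, Prop 4.4 (i) p.129] -/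
def Prop44i : Prop :=
  ∃! φ : X.OC ≃* unitDiscMonoid X.Afield, ∀ m : X.OC, (φ m : X.Afield) = X.kappa m

/-- Any isomorphism through which `†κ_v` factors IS `kummerIsoArch` (the inclusion `A^▷ ⊆ 𝒜` is injective).
[cite: Mochizuki2012, Prop 4.4 (i) p.129] -/
theorem eq_kummerIsoArch {φ : X.OC ≃* unitDiscMonoid X.Afield}
    (hφ : ∀ m : X.OC, (φ m : X.Afield) = X.kappa m) : φ = kummerIsoArch X :=
  MulEquiv.ext fun m => Subtype.ext ((hφ m).trans (coe_kummerIsoArch X m).symm)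

/-- **[IUTchII] Prop 4.4 (i) PROVED** for every instance of abc-iut-L5-t2's [IUTchI] Ex 3.4 interface.
[cite: Mochizuki2012, Prop 4.4 (i) p.129] -/
theorem Prop44i_holds : Prop44i X :=
  ⟨kummerIsoArch X, coe_kummerIsoArch X, fun _ hφ => eq_kummerIsoArch X hφ⟩

end ConstantMonoids

/-! ### 3. Prop 4.4 (ii), unit part: a unique `{±1}`-orbit of isomorphisms of unit circles -/

section UnitPart

/-- Inversion on a commutative topological group, as an isomorphism of topological groups (the
generator of the printed `{±1}`-indeterminacy). [cite: Mochizuki2012, Prop 4.4 (ii) p.129] -/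
def invEquiv (H : Type*) [CommGroup H] [TopologicalSpace H] [IsTopologicalGroup H] : H ≃ₜ* H :=
  { MulEquiv.inv H with
    continuous_toFun := continuous_inv
    continuous_invFun := continuous_inv }

/-- `invEquiv H h = h⁻¹`. [cite: Mochizuki2012, Prop 4.4 (ii) p.129] -/
@[simp] theorem invEquiv_apply {H : Type*} [CommGroup H] [TopologicalSpace H] [IsTopologicalGroup H]
    (h : H) : invEquiv H h = h⁻¹ := rfl

open Literature.AnabelianGeometry.AbsoluteAnabelian.AbsTopIII in
/-- Transport of the tree's classification of continuous automorphisms of `S¹` (abc-iut-L4's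
`Rmk_2_7_3.CircleAutOrderTwo_holds`: every `f : S¹ ⥲ S¹` is `z ↦ z` or `z ↦ z⁻¹`): for commutative topological
groups `G`, `H` each isomorphic to `S¹`, the isomorphisms of topological groups `G ⥲ H` form EXACTLY ONE
orbit under `{±1}` (post-composition with inversion) — some `ψ` exists and every `ψ'` is `ψ` or `ψ`
followed by inversion. [cite: Mochizuki2012, Prop 4.4 (ii) p.129] -/
theorem orbit_of_equiv_circle {G H : Type*} [CommGroup G] [TopologicalSpace G]
    [IsTopologicalGroup G] [CommGroup H] [TopologicalSpace H] [IsTopologicalGroup H]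
    (eG : G ≃ₜ* Circle) (eH : H ≃ₜ* Circle) :
    ∃ ψ : G ≃ₜ* H, ∀ ψ' : G ≃ₜ* H, ψ' = ψ ∨ ψ' = ψ.trans (invEquiv H) := by
  refine ⟨eG.trans eH.symm, fun ψ' => ?_⟩
  rcases Rmk_2_7_3.CircleAutOrderTwo_holds (eG.symm.trans (ψ'.trans eH)) with h | h
  · left
    ext g
    have hg := congrArg (fun f : Circle ≃ₜ* Circle => eH.symm (f (eG g))) h
    simpa using hg
  · right
    ext g
    have hg := congrArg (fun f : Circle ≃ₜ* Circle => eH.symm (f (eG g))) h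
    simp only [ContinuousMulEquiv.trans_apply, ContinuousMulEquiv.symm_apply_apply,
      Rmk_2_7_3.circleInv_apply, map_inv] at hg
    simpa using hg

/-- **Unit circles of complex archimedean fields**: for normed fields `A`, `B` each bicontinuously
ring-isomorphic to `ℂ` (CAFs), the isomorphisms of topological groups `S¹(A) ⥲ S¹(B)` form exactly one
`{±1}`-orbit. [cite: Mochizuki2012, Prop 4.4 (ii) p.129] -/
theorem orbit_sphere {A B : Type*} [NormedField A] [NormedField B]
    (hA : ∃ e : A ≃+* ℂ, Continuous e ∧ Continuous e.symm)
    (hB : ∃ e : B ≃+* ℂ, Continuous e ∧ Continuous e.symm) :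
    ∃ ψ : Metric.sphere (0 : A) 1 ≃ₜ* Metric.sphere (0 : B) 1,
      ∀ ψ' : Metric.sphere (0 : A) 1 ≃ₜ* Metric.sphere (0 : B) 1,
        ψ' = ψ ∨ ψ' = ψ.trans (invEquiv _) := by
  obtain ⟨eA, hA1, hA2⟩ := hA
  obtain ⟨eB, hB1, hB2⟩ := hB
  exact orbit_of_equiv_circle (sphereEquiv eA hA1 hA2) (sphereEquiv eB hB1 hB2)

variable {Kv : Type u} [NormedField Kv] [NormedAlgebra ℝ Kv]

/-- `Ψ^×_{†F^⊢_v} = O^×_{C⊢_v}` (abc-iut-L5-t2's `unitsDash X = X.OCˣ`) IS the unit circle `S¹(K_v)` as a group, via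
`O^▷(C_v) ⥲ O^▷_{K_v}` and `(O^▷_{K_v})^× = S¹(K_v)`. [cite: Mochizuki2012, Prop 4.4 (ii) p.129] -/
def unitsDashEquivSphere (X : ArchLocalFrobenioid.{u} Kv) : X.unitsDash ≃* Metric.sphere (0 : Kv) 1 :=
  (Units.mapEquiv X.isoOK).trans unitsUnitDiscEquivSphere

/-- `K_v` itself is a CAF: bicontinuously ring-isomorphic to `ℂ` (compose the interface's `K_v ⥲ 𝒜_{D_v}`
with `𝒜_{D_v} ≅ ℂ`). [cite: Mochizuki2012, Prop 4.4 (ii) p.129] -/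
theorem base_isCAF (X : ArchLocalFrobenioid.{u} Kv) : ∃ e : Kv ≃+* ℂ, Continuous e ∧ Continuous e.symm := by
  obtain ⟨e, he, he'⟩ := X.caf
  refine ⟨X.fieldIso.trans e, he.comp X.fieldIso_continuous, ?_⟩
  change Continuous (fun x => X.fieldIso.symm (e.symm x))
  exact X.fieldIso_continuous_symm.comp he'

/-- **REAL STATEMENT of the unit part of [IUTchII] Prop 4.4 (ii)** (pp. 129–130: "there exists a unique
`{±1}`-orbit of isomorphisms of topological groups `Ψ^×_{†F^⊢_v} ⥲ Ψ_cns(†D^⊢_v)^×`") for an instance `X` of the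
[IUTchI] Ex 3.4 interface, at the level of the unit circles `S¹(K_v) ≅ Ψ^×_{†F^⊢_v}` (`unitsDashEquivSphere`) and
`S¹(𝒜_{†D_v}) = Ψ_cns(†D^⊢_v)^×` (`isUnit_iff_norm_eq_one`): the isomorphisms of topological groups form EXACTLY
ONE `{±1}`-orbit — some `ψ` exists and every `ψ'` is `ψ` or `ψ` followed by inversion. The slot it makes
real: `Prop44Statements.unitOrbit` (p404158). [cite: Mochizuki2012, Prop 4.4 (ii) p.129] -/
def Prop44iiUnit (X : ArchLocalFrobenioid.{u} Kv) : Prop :=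
  ∃ ψ : Metric.sphere (0 : Kv) 1 ≃ₜ* Metric.sphere (0 : X.Afield) 1,
    ∀ ψ' : Metric.sphere (0 : Kv) 1 ≃ₜ* Metric.sphere (0 : X.Afield) 1,
      ψ' = ψ ∨ ψ' = ψ.trans (invEquiv _)

/-- **[IUTchII] Prop 4.4 (ii), unit part, PROVED** for every instance of the [IUTchI] Ex 3.4 interface.
[cite: Mochizuki2012, Prop 4.4 (ii) p.129] -/
theorem Prop44iiUnit_holds (X : ArchLocalFrobenioid.{u} Kv) : Prop44iiUnit X :=
  orbit_sphere (base_isCAF X) X.caf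

end UnitPart

end GoodPrimeKummer

end Literature.IUT.HodgeArakelov

end
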